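import Summits.HodgeConjecture.HodgeCM.Model.WeilCentralCoinvariants_2
import Literature.NumberTheory.GelbartRogawski1991.UnitaryDualPairWeilCoinvariants
import HarnessLib

/-!
# FLOOR-0 P4, seat S4′(i), junction J-2 — the MODEL'S finite Weil representation ∕ `χ`-coinvariants ARE the Literature's (GR91 ∕ Liu carriers),
# definitionally

Cell hodgecm-mathlib (D-0151), FLOOR 0, crux item H413 = stmt-HodgeConjecture-24833; programme P4, line
`Cruxes/H413/Lines/F0_P4AdmissibleOccursInH1.lean`, stub S4′ `stub_T3a_holThetaRealisationOfRallisAt`.  Author F0P4-p01 (g0) (seat (i)).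
`--supports stmt-HodgeConjecture-24833 --as helper`.  DEF-FREE; every proof is `rfl`.

JUNCTION J (SEAT-i MEMO v1 §3; DECISIONS-T3a D2) must identify the finite Weil representation `D₀.ωf = finRepZero …` of the model's
theta-distribution datum at the admissible line (★ `Theorems/H413ThetaDistAtLine.distDatumAt_ωf`) with the pin's carrier
`ω_V(t) = omegaAtLine … a χ = TwistedCoinv.Coinv (finPairRepW … (hs a)) (lineChar a χ)` (★ `Liu2021/Def411WeilCarriersAtLine`).  The model
builds `finRepZero` from ITS OWN port `HodgeCM.WeilCoinv.finPairRep` ∕ `HodgeCM.TwistedCoinv.Coinv` ∕ `HodgeCM.WeilCoinv.weilCoinv`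
(`HodgeCM/Model/WeilCentralCoinvariants_1∕_2`), the pin from the Literature's `UnitaryDualPair.WeilCoinv.finPairRep` ∕
`Literature.RepresentationTheory.TwistedCoinv.Coinv` ∕ `UnitaryDualPair.WeilCoinv.weilCoinv` (`GelbartRogawski1991/UnitaryDualPairWeilCoinvariants`,
`RepresentationTheory/TwistedCoinvariants`).  This file records that the two families are THE SAME TERMS (the port is verbatim): for every
pair datum and every compatible splitting `s`,

* `finPairRep_twin`, `finPairRepV_twin`, `finPairRepW_twin` — the finite Weil representation of the pair and its two members;
* `coinv_twin` — the `χ`-coinvariant carrier `Ω(s, χ)`;  `weilCoinv_twin` — its `U(J_V)(𝔸_f)`-action;  `weilCoinvLift_twin` — the descent of a `χ`-covariant map.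

Hence J reduces to: (a) the SPLITTING (model: `splittingOf hGR₀ = hGR₀.choose`; pin: the `μ`-splitting `s_μ a`) — two compatible splittings of one datum
differ by a continuous character trivial on rational points (★ `IsCompatible.exists_central_twist`, ★ `adelicMpCont.exists_eq_twist_continuous`), absorbed by
the model's knobs `η`∕`ν` (★ `ThetaDistAtLine.sideAt`); (b) the W-Gram SPELLING (model `Matrix.diagonal (lineVec a)`∕`realDiagonal`, pin `JW a = !![a]`∕`TW a`);
(c) the frame congruence `finFrameCongr` on `U(V)` and the reindex `finSBReindex e₁`; (d) the scalar `finCharZero = η₀ · cmLineChar₀`; plus the line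
transport (LT) `a_t ↦ a_e` (A-p17 (g12)).  HC_CM is proved only modulo the printed citations until rung 0 closes.

## References
* [GelbartRogawski1991] S. Gelbart, J. Rogawski, Invent. Math. 105 (1991), §3.1 Prop. 3.1.1 p. 455, Remark p. 457.
* [Liu2021] Y. Liu, Camb. J. Math. 9 (2021) = arXiv:2102.11518, Def. 4.11, App. D §D.1 Steps 2–3.
* Tree: ★ `HodgeCM/Model/WeilCentralCoinvariants_1∕_2`, ★ `Literature/NumberTheory/GelbartRogawski1991/UnitaryDualPairWeilCoinvariants`,
  ★ `Literature/RepresentationTheory/TwistedCoinvariants`.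
-/

set_option autoImplicit false
set_option linter.dupNamespace false

noncomputable section

open Literature.NumberTheory.GelbartRogawski1991 Literature.NumberTheory.GelbartRogawski1991.UnitaryDualPair
open Literature.NumberTheory.Automorphic Literature.NumberTheory.Weil1964
open scoped Kronecker
open NumberField

namespace Summit.HodgeConjecture.HodgeConjecture.Cruxes.H413.ThetaJunction

variable (F E : Type) [Field F] [NumberField F] [Field E] [NumberField E] [Algebra F E]
variable (c : E ≃ₐ[F] E) (N M : ℕ) {n : ℕ} (e : Fin N × Fin M ≃ Fin n)
variable (JV : Matrix (Fin N) (Fin N) E) (JW : Matrix (Fin M) (Fin M) E)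
variable {TV : Matrix (Fin N) (Fin N) F} {TW : Matrix (Fin M) (Fin M) F}
variable [Algebra.IsQuadraticExtension F E] {δ : E} (hcδ : c δ = -δ) (hδ : δ ≠ 0) {d : F}
  (hd : δ * δ = algebraMap F E d) (hV : TV.IsSymm) (hW : TW.IsSymm) (hVd : IsUnit TV.det) (hWd : IsUnit TW.det)
  (hJV : JV = TV.map (algebraMap F E)) (hJW : JW = TW.map (algebraMap F E))
  {s : UnitaryGroup.adelicPair F E c N M JV JW →* adelicMpCont F (Fin n) (adelicGram F e TV TW)}
  (hs : (splittingDatum F E c N M e JV JW hcδ hδ hd hV hW hVd hWd hJV hJW).IsCompatible s)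

/-- **J-2 (pair)**: the model's finite Weil representation of the pair IS the Literature's. [cite: GelbartRogawski1991, §3.1 Prop. 3.1.1 p. 455] -/
theorem finPairRep_twin :
    HodgeCM.WeilCoinv.finPairRep F E c N M e JV JW hcδ hδ hd hV hW hVd hWd hJV hJW hs =
      UnitaryDualPair.WeilCoinv.finPairRep F E c N M e JV JW hcδ hδ hd hV hW hVd hWd hJV hJW hs :=
  rfl

/-- **J-2 (`U(J_V)`-member)**. [cite: GelbartRogawski1991, §3.1 Prop. 3.1.1 p. 455] -/
theorem finPairRepV_twin :
    HodgeCM.WeilCoinv.finPairRepV F E c N M e JV JW hcδ hδ hd hV hW hVd hWd hJV hJW hs =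
      UnitaryDualPair.WeilCoinv.finPairRepV F E c N M e JV JW hcδ hδ hd hV hW hVd hWd hJV hJW hs :=
  rfl

/-- **J-2 (`U(J_W)`-member)**. [cite: GelbartRogawski1991, §3.1 Prop. 3.1.1 p. 455] -/
theorem finPairRepW_twin :
    HodgeCM.WeilCoinv.finPairRepW F E c N M e JV JW hcδ hδ hd hV hW hVd hWd hJV hJW hs =
      UnitaryDualPair.WeilCoinv.finPairRepW F E c N M e JV JW hcδ hδ hd hV hW hVd hWd hJV hJW hs :=
  rfl

variable (χ : UnitaryGroup.finAdelic F E c M JW →* ℂˣ)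

/-- **J-2 (carrier)**: the model's `χ`-coinvariant space `Ω(s, χ)` IS the Literature's `TwistedCoinv.Coinv` of the Literature's `finPairRepW` —
so at the pin's own splitting and line it IS `omegaAtLine … a χ`'s carrier. [cite: Liu2021, Def. 4.11; App. D §D.1 Step 3] -/
theorem coinv_twin :
    HodgeCM.TwistedCoinv.Coinv (HodgeCM.WeilCoinv.finPairRepW F E c N M e JV JW hcδ hδ hd hV hW hVd hWd hJV hJW hs) χ =
      Literature.RepresentationTheory.TwistedCoinv.Coinv
        (UnitaryDualPair.WeilCoinv.finPairRepW F E c N M e JV JW hcδ hδ hd hV hW hVd hWd hJV hJW hs) χ :=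
  rfl

/-- **J-2 (action)**: the model's `U(J_V)(𝔸_f)`-action on `Ω(s, χ)` IS the Literature's `weilCoinv` (the pin's `rhoVAtLine` at its own splitting).
[cite: Liu2021, Def. 4.11; App. D §D.1 Steps 2–3] -/
theorem weilCoinv_twin :
    HodgeCM.WeilCoinv.weilCoinv F E c N M e JV JW hcδ hδ hd hV hW hVd hWd hJV hJW χ hs =
      UnitaryDualPair.WeilCoinv.weilCoinv F E c N M e JV JW hcδ hδ hd hV hW hVd hWd hJV hJW χ hs :=
  rfl

/-- **J-2 (descent)**: the model's `weilCoinvLift` of a `χ`-covariant map IS the Literature's. [cite: GelbartRogawski1991, §3.1 Remark p. 457] -/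
theorem weilCoinvLift_twin {H : Type*} [AddCommGroup H] [Module ℂ H] (f : FinSB F (Fin N × Fin M) →ₗ[ℂ] H)
    (hf : ∀ (u : UnitaryGroup.finAdelic F E c M JW) (φ : FinSB F (Fin N × Fin M)),
      f (UnitaryDualPair.WeilCoinv.finPairRep F E c N M e JV JW hcδ hδ hd hV hW hVd hWd hJV hJW hs (1, u) φ) = ((χ u : ℂˣ) : ℂ) • f φ) :
    HodgeCM.WeilCoinv.weilCoinvLift F E c N M e JV JW hcδ hδ hd hV hW hVd hWd hJV hJW χ hs f hf =
      UnitaryDualPair.WeilCoinv.weilCoinvLift F E c N M e JV JW hcδ hδ hd hV hW hVd hWd hJV hJW χ hs f hf :=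
  rfl

end Summit.HodgeConjecture.HodgeConjecture.Cruxes.H413.ThetaJunction

end
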